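import Mathlib
import Summits.NavierStokesRegularity.NavierStokesRegularity.Theorems.TypeIQuarterGateScarEnvelopeTypeISatelliteTowerEnvelopeLeaves

/-!
# Shared helper (P2 of ns-wall-crit-1 V4/V5; director-ns KEY-NS #153 (g)/(h)): topology of the
final-time scar set of an Albritton–Barker object and the ISOLATED-SCAR / PERFECTNESS DICHOTOMY

ONE module for the statement filed twice — by ns-idea-18 «countable-scars»
(`Cruxes/ScarEnvelopeTypeI/CountableScarsSketch.lean`: `exists_scar_near_of_noOneScarLeaf`,
`perfect_scarSet_of_noOneScarLeaf`) and by ns-idea-17 «isolation-radius»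
(`Cruxes/ScarEnvelopeTypeI/IsolationSketch.lean`: `oneScarLeaf_of_isolatedScar`,
`noOneScarLeaf_iff_scarsAccumulate`; priority ceded to «countable-scars», which this file serves).
Landing-ready for the LEAD 23843 lineage (KEY-NS #153 (h): `--supports stmt-NavierStokesRegularity-23843
--as helper`, suggested target `Theorems/TypeIQuarterGateScarEnvelopeTypeIScarSetTopology.lean`); both
sketches then import it and drop their private copies.  Reductions / normal forms only — NOT the crux:
NS regularity is NOT proved, 23843 and both kernel exclusions stay OPEN.  0 sorry.

Contents: `scarSet`; `isOpen_regPt`, `isClosed_scarSet` (half-radius cylinder); `regPt_zoom_of_regPt`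
(regularity transports along exact parabolic zooms about any centre); `regPt_zero_congr_ae`
(regularity at the origin transfers across a.e. agreement on the cylinders `Q_R(0)`, `R < 1` — the
form in which `abTower_closed` hands over tangent flows); the dichotomy in its three typed forms
`oneScarLeaf_of_isolatedScar` (one object: an isolated scar, zoomed to the origin, IS a one-scar leaf
of the same rate), `exists_scar_near_of_noOneScarLeaf`, `perfect_scarSet_of_noOneScarLeaf`, and the
iff `noOneScarLeaf_iff_perfectScarSets`; `not_countable_of_closed_of_acc` (Baire / Cantor–Bendixson:
a nonempty closed dense-in-itself subset of `ℝ³` is uncountable).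
-/

set_option linter.dupNamespace false

open MeasureTheory Set Metric Filter Topology
open scoped ENNReal

namespace Summit.NavierStokesRegularity.NavierStokesRegularity.Cruxes.ScarEnvelopeTypeI.ZoomDictionary

namespace ScarTopology

open Literature.Analysis.FluidPDE

local notation "E3" => EuclideanSpace ℝ (Fin 3)

/-- The final-time SCAR SET of an ancient field: the points `y` such that the field is not
essentially bounded on any parabolic cylinder below `(0, y)`. -/
def scarSet (U : ℝ → E3 → E3) : Set E3 := {y | ¬ RegPt U y}

theorem mem_scarSet {U : ℝ → E3 → E3} {y : E3} : y ∈ scarSet U ↔ ¬ RegPt U y := Iff.rfl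

/-- `satellites U = scarSet U ∖ {0}`. -/
theorem satellites_eq_scarSet_diff (U : ℝ → E3 → E3) : satellites U = scarSet U \ {0} := by
  ext y
  simp only [satellites, scarSet, mem_setOf_eq, Set.mem_sdiff, mem_singleton_iff]
  exact and_comm

/-! ## 1. The scar set is closed -/

/-- Regular final-time points form an open set: the witnessing cylinder of `y` serves `y'` near `y`
with half the radius. -/
theorem isOpen_regPt (U : ℝ → E3 → E3) : IsOpen {y : E3 | RegPt U y} := by
  rw [Metric.isOpen_iff]
  rintro y ⟨r, hr, M, hM⟩
  refine ⟨r / 2, by positivity, fun y' hy' => ?_⟩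
  rw [mem_ball] at hy'
  refine ⟨r / 2, by positivity, M, ?_⟩
  have hsub : parabolicCylinder (r / 2) (((0 : ℝ), y') : ℝ × E3) ⊆
      parabolicCylinder r (((0 : ℝ), y) : ℝ × E3) := by
    intro w hw
    rw [mem_parabolicCylinder] at hw ⊢
    obtain ⟨⟨h1, h2⟩, h3⟩ := hw
    refine ⟨⟨?_, h2⟩, ?_⟩
    · have : (r / 2) ^ 2 ≤ r ^ 2 := by nlinarith
      simp only at h1 ⊢
      linarith
    · calc dist w.2 y ≤ dist w.2 y' + dist y' y := dist_triangle _ _ _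
        _ < r / 2 + r / 2 := by simp only at h3; exact add_lt_add h3 hy'
        _ = r := by ring
  exact ae_restrict_of_ae_restrict_of_subset hsub hM

/-- The scar set is closed. -/
theorem isClosed_scarSet (U : ℝ → E3 → E3) : IsClosed (scarSet U) := by
  have : scarSet U = {y : E3 | RegPt U y}ᶜ := rfl
  rw [this]
  exact (isOpen_regPt U).isClosed_compl

/-! ## 2. Regularity transports along exact zooms and across a.e. agreement -/

/-- If `U` is regular at `(0, y₀ + c y)` then the zoom `zoom U y₀ 0 c = c • U(c² ·, y₀ + c ·)` is
regular at `(0, y)`. -/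
theorem regPt_zoom_of_regPt {c : ℝ} (hc0 : 0 < c) {U : ℝ → E3 → E3} {y₀ y : E3}
    (h : RegPt U (y₀ + c • y)) : RegPt (zoom U y₀ 0 c) y := by
  obtain ⟨r, hr, M, hM⟩ := h
  refine ⟨c⁻¹ * r, by positivity, c * M, ?_⟩
  have hpre : stAffine (c ^ 2) c 0 y₀ ⁻¹' parabolicCylinder r (((0 : ℝ), y₀ + c • y) : ℝ × E3) =
      parabolicCylinder (c⁻¹ * r) (((0 : ℝ), y) : ℝ × E3) := by
    have h1 := LocalTypeIScaling.stAffine_preimage_parabolicCylinder hc0 (0 : ℝ) y₀ (c⁻¹ * r)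
      (((0 : ℝ), y) : ℝ × E3)
    have e : stAffine (c ^ 2) c 0 y₀ (((0 : ℝ), y) : ℝ × E3) = ((0 : ℝ), y₀ + c • y) := by
      rw [stAffine_apply, mul_zero, add_zero]
    rw [e, show c * (c⁻¹ * r) = r by field_simp] at h1
    exact h1
  have h2 := ae_restrict_preimage_stAffine (pow_pos hc0 2) hc0 (0 : ℝ) y₀ hM
  rw [hpre] at h2
  filter_upwards [h2] with z hz
  obtain ⟨s, y'⟩ := z
  rw [stAffine_apply] at hz
  dsimp only at hz
  show ‖c • U (0 + c ^ 2 * s) (y₀ + c • y')‖ ≤ c * M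
  rw [norm_smul, Real.norm_of_nonneg hc0.le]
  exact mul_le_mul_of_nonneg_left hz hc0.le

/-- Regularity at the final-time origin transfers across a.e. agreement on the cylinders `Q_R(0)`,
`R < 1` (the form in which `abTower_closed` hands over A–B representatives of tangent flows). -/
theorem regPt_zero_congr_ae {Ū U' : ℝ → E3 → E3}
    (hae : ∀ R ∈ Ioo (0 : ℝ) 1, ∀ᵐ z ∂(volume.restrict (parabolicCylinder R (0 : ℝ × E3))),
      Ū z.1 z.2 = U' z.1 z.2)
    (h : RegPt U' 0) : RegPt Ū 0 := by
  obtain ⟨r, hr, M, hM⟩ := h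
  set r₁ : ℝ := min r (1 / 2) with hr₁
  have hr₁0 : 0 < r₁ := lt_min hr (by norm_num)
  have hr₁1 : r₁ < 1 := (min_le_right _ _).trans_lt (by norm_num)
  have hsub : parabolicCylinder r₁ (((0 : ℝ), (0 : E3)) : ℝ × E3) ⊆
      parabolicCylinder r (((0 : ℝ), (0 : E3)) : ℝ × E3) :=
    parabolicCylinder_mono hr₁0.le (min_le_left _ _) _
  have hM₁ : ∀ᵐ z ∂(volume.restrict (parabolicCylinder r₁ (((0 : ℝ), (0 : E3)) : ℝ × E3))),
      ‖U' z.1 z.2‖ ≤ M := ae_restrict_of_ae_restrict_of_subset hsub hM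
  have hae₁ : ∀ᵐ z ∂(volume.restrict (parabolicCylinder r₁ (((0 : ℝ), (0 : E3)) : ℝ × E3))),
      Ū z.1 z.2 = U' z.1 z.2 := hae r₁ ⟨hr₁0, hr₁1⟩
  refine ⟨r₁, hr₁0, M, ?_⟩
  filter_upwards [hM₁, hae₁] with z h1 h2
  rw [h2]
  exact h1

/-! ## 3. The dichotomy: an isolated scar is a one-scar leaf; under (E1) scars accumulate -/

/-- **One object, one scar, one leaf.**  If `y₀` is a scar of an A–B object of rate `M` and every
other point of `B(y₀, ρ)` is regular, then the exact zoom about `y₀` with factor `ρ` is a ONE-SCAR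
LEAF of the same rate (`abTower_zoom` keeps the class, `regPt_of_regPt_zoom_zero` keeps the scar at
the new origin, `regPt_zoom_of_regPt` transports the regular annulus onto `B₁ ∖ {0}`). -/
theorem oneScarLeaf_of_isolatedScar {M : ℝ} {U : ℝ → E3 → E3} {P : ℝ → E3 → ℝ}
    {H : ℝ → E3 → E3 →L[ℝ] E3} (hAB : ABTower M U P H) {y₀ : E3} (hy₀ : ¬ RegPt U y₀)
    {ρ : ℝ} (hρ : 0 < ρ) (hiso : ∀ y : E3, y ≠ y₀ → dist y y₀ < ρ → RegPt U y) :
    OneScarLeaf M := by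
  refine ⟨_, _, _, abTower_zoom hAB y₀ hρ, ?_, fun y hy0 hy1 => ?_⟩
  · intro h
    refine hy₀ (regPt_of_regPt_zoom_zero hρ ?_)
    rwa [zoom_eq_smul_stPull]
  · rw [← zoom_eq_smul_stPull]
    refine regPt_zoom_of_regPt hρ (hiso _ ?_ ?_)
    · intro heq
      apply hy0
      have : ρ • y = 0 := by simpa using heq
      exact (smul_eq_zero.1 this).resolve_left hρ.ne'
    · rw [dist_eq_norm, add_sub_cancel_left, norm_smul, Real.norm_of_nonneg hρ.le]
      calc ρ * ‖y‖ < ρ * 1 := mul_lt_mul_of_pos_left hy1 hρ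
        _ = ρ := mul_one ρ

/-- **No isolated scars under `∀ M, ¬ OneScarLeaf M`** (contrapositive of the previous lemma). -/
theorem exists_scar_near_of_noOneScarLeaf (hE1 : ∀ M : ℝ, ¬ OneScarLeaf M) {M : ℝ}
    {U : ℝ → E3 → E3} {P : ℝ → E3 → ℝ} {H : ℝ → E3 → E3 →L[ℝ] E3} (hAB : ABTower M U P H)
    {y₀ : E3} (hy₀ : ¬ RegPt U y₀) {ρ : ℝ} (hρ : 0 < ρ) :
    ∃ y : E3, y ≠ y₀ ∧ dist y y₀ < ρ ∧ ¬ RegPt U y := by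
  by_contra hne
  refine hE1 M (oneScarLeaf_of_isolatedScar hAB hy₀ hρ fun y hy hd => ?_)
  by_contra hreg
  exact hne ⟨y, hy, hd, hreg⟩

/-- **Dichotomy (set form).** Under the first kernel exclusion the final-time scar set of every
Albritton–Barker object is PERFECT (closed, dense-in-itself; Mathlib's `Perfect` allows `∅`). -/
theorem perfect_scarSet_of_noOneScarLeaf (hE1 : ∀ M : ℝ, ¬ OneScarLeaf M) {M : ℝ}
    {U : ℝ → E3 → E3} {P : ℝ → E3 → ℝ} {H : ℝ → E3 → E3 →L[ℝ] E3}
    (hAB : ABTower M U P H) : Perfect (scarSet U) := by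
  refine ⟨isClosed_scarSet U, (preperfect_iff_nhds).2 fun y hy V hV => ?_⟩
  obtain ⟨ρ, hρ, hball⟩ := Metric.mem_nhds_iff.1 hV
  obtain ⟨y', hne, hd, hy'⟩ := exists_scar_near_of_noOneScarLeaf hE1 hAB hy hρ
  exact ⟨y', ⟨hball (Metric.mem_ball.2 hd), hy'⟩, hne⟩

/-- **Dichotomy (iff).** The first kernel exclusion holds iff every A–B scar set is perfect: a
one-scar leaf has the isolated scar `0`. -/
theorem noOneScarLeaf_iff_perfectScarSets :
    (∀ M : ℝ, ¬ OneScarLeaf M) ↔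
      ∀ (M : ℝ) (U : ℝ → E3 → E3) (P : ℝ → E3 → ℝ) (H : ℝ → E3 → E3 →L[ℝ] E3),
        ABTower M U P H → Perfect (scarSet U) := by
  refine ⟨fun hE1 M U P H hAB => perfect_scarSet_of_noOneScarLeaf hE1 hAB, fun h M hleaf => ?_⟩
  obtain ⟨U, P, H, hAB, h0, hreg⟩ := hleaf
  have hP := h M U P H hAB
  have hacc := (preperfect_iff_nhds).1 hP.2 0 h0 (ball 0 1) (ball_mem_nhds _ one_pos)
  obtain ⟨y', ⟨hyb, hys⟩, hne⟩ := hacc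
  exact hys (hreg y' hne (by simpa using hyb))

/-! ## 4. Baire: closed + dense-in-itself + nonempty ⇒ uncountable -/

/-- A nonempty closed subset of `ℝ³` each of whose points is an accumulation point of it is not
countable (Baire category in the complete subspace; Cantor–Bendixson). -/
theorem not_countable_of_closed_of_acc {S : Set E3} (hcl : IsClosed S) (hne : S.Nonempty)
    (hacc : ∀ y ∈ S, ∀ ρ : ℝ, 0 < ρ → ∃ y' ∈ S, y' ≠ y ∧ dist y' y < ρ) : ¬ S.Countable := by
  intro hcount
  haveI : IsClosed S := hcl
  haveI : Countable S := hcount.to_subtype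
  haveI : Nonempty S := hne.to_subtype
  obtain ⟨p₀, hint⟩ := nonempty_interior_of_iUnion_of_closed (X := S)
    (f := fun p : S => ({p} : Set S)) (fun p => isClosed_singleton) (by ext p; simp)
  have heq : interior ({p₀} : Set S) = {p₀} :=
    (subset_singleton_iff_eq.mp interior_subset).resolve_left hint.ne_empty
  have hopen : IsOpen ({p₀} : Set S) := heq ▸ isOpen_interior
  rw [Metric.isOpen_iff] at hopen
  obtain ⟨ε, hε, hball⟩ := hopen p₀ rfl
  obtain ⟨y', hy'S, hne', hdist⟩ := hacc p₀.1 p₀.2 ε hε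
  have hmem : (⟨y', hy'S⟩ : S) ∈ ball p₀ ε := by
    rw [mem_ball]
    exact hdist
  have h1 := hball hmem
  rw [mem_singleton_iff] at h1
  exact hne' (congrArg Subtype.val h1)

/-- Under (E1), a nonempty A–B scar set is uncountable. -/
theorem not_countable_scarSet_of_noOneScarLeaf (hE1 : ∀ M : ℝ, ¬ OneScarLeaf M) {M : ℝ}
    {U : ℝ → E3 → E3} {P : ℝ → E3 → ℝ} {H : ℝ → E3 → E3 →L[ℝ] E3} (hAB : ABTower M U P H)
    (hne : (scarSet U).Nonempty) : ¬ (scarSet U).Countable :=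
  not_countable_of_closed_of_acc (isClosed_scarSet U) hne fun y hy ρ hρ => by
    obtain ⟨y', hne', hd, hy'⟩ := exists_scar_near_of_noOneScarLeaf hE1 hAB hy hρ
    exact ⟨y', hy', hne', hd⟩

end ScarTopology

end Summit.NavierStokesRegularity.NavierStokesRegularity.Cruxes.ScarEnvelopeTypeI.ZoomDictionary
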